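import Literature.AlgebraicGeometry.Limits.LocalizationRelativeHomSpread
import Literature.AlgebraicGeometry.AbelianSchemes.EndomorphismStructureLocus
import HarnessLib

/-!
# SPREAD SEQUEL (s1): a RING ACTION on the generic base change of a stage abelian scheme spreads to a finer stage
# (EGA IV₃ 8.8.2 (i) for the finitely many endomorphisms `ι(b_j)` + the endomorphism-structure table at the stage; [Kottwitz1992] §5)

Layer `Literature/AlgebraicGeometry/AbelianSchemes`, namespace `Literature.AlgebraicGeometry.AbelianSchemes.AbelianSchemeOver`.  THEOREMS ONLY
(no definition, no named fact, no instance, no notation, no `sorry`).  Sequel of ★ `Limits/LocalizationRelativeHomSpread` (FILE 1: a finite family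
of generic morphisms spreads to one stage and is determined there) and ★ `AbelianSchemes/EndomorphismStructureLocus` §3 (`ι(Σ a_j b_j) := ∏ y_j^{a_j}` is a
ring action as soon as the multiplication table and the unit identity hold).  Cell `hodgecm-mathlib` (D-0151), FLOOR 0, P6 «MOD programme» (crux
hLiu418 = stmt-HodgeConjecture-24832), SPREAD door, deal «SPREAD SEQUELS (s1)–(s3)» (LEAD F0P6-plan (g2) 2026-09-01 21:22:30Z; B-p18 (g37)),
item (s1); consumed by the `stub_RGD` assembly (GEN heir A-p18) and E6 (A-p06 heir).  HC_CM is proved only modulo the printed citations until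
rung 0 closes; this file is generic and changes no count.

SETTING (frame of ★ SP1 (e) `AbelianSchemeOverSpreadStage` and ★ (d) `LocalizationRelativeGroupSpreadDock`): `A` a domain with fraction field
`K`, `P → Spec A` quasi-compact quasi-separated, a stage `t : Idx (nonZeroDivisors A)` with `P ⊗ D(t) → D(t)` flat, an abelian scheme `𝒜ₜ` over
`P ⊗ D(t)` with commutative law, and a ring action `ρ : RingAction O (𝒜ₜ ×_{P_t} (P ⊗ Spec K))` of an order `O` with ℤ-basis `b` on its GENERIC
base change.  CONCLUSION (`exists_stage_ringAction`): a finer stage `σ : s ⟶ t` and a ring action `ρₛ` on the restriction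
`𝒜ₛ := 𝒜ₜ ×_{P_t} (P ⊗ D(s))` whose base change along the relative leg is `ρ` through the canonical identification `(𝒜ₛ)_K ≅ (𝒜ₜ)_K`
(★ `OverFac.facObjIso`).  ROUTE: spread the `n` endomorphisms `ρ(b_j)` (FILE 1 §1); the base-change functor along the relative leg is injective
on morphisms from flat to separated schemes (FILE 1 §2) and is a group homomorphism on `Hom` (monoidal), the identification `(𝒜ₛ)_K ≅ (𝒜ₜ)_K` is an
isomorphism of group schemes for the INDUCED structures (§1 `isMonHom_facObjIso_hom`, from ★ `OverFac.map_ε∕μ_comp_facObjIso_hom`) — so the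
spread `z_j` are homomorphisms (§2) and satisfy the table of `O` (§3), whence ★ `exists_ringAction_of_structureTable`.

## References
* [EGAIV3] A. Grothendieck, J. Dieudonné, *EGA IV₃* (1966), Thm. 8.8.2 (i); 11.10.5.
* [Kottwitz1992] R. Kottwitz, *Points on some Shimura varieties over finite fields*, JAMS 5 (1992), §5 (p. 390).
* [GortzWedhorn2020] U. Görtz, T. Wedhorn, *Algebraic Geometry I*, 2nd ed. (2020), §(4.7) (4.7.1), Prop. 4.16, Prop. 9.19 and Rem. 9.20.
-/

set_option autoImplicit false

noncomputable section

universe u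

open CategoryTheory CategoryTheory.Limits AlgebraicGeometry MonoidalCategory CartesianMonoidalCategory MonObj
open Functor.LaxMonoidal Functor.OplaxMonoidal
open scoped CategoryTheory.Obj

namespace Literature.AlgebraicGeometry.AbelianSchemes

namespace AbelianSchemeOver

open Literature.AlgebraicGeometry.Limits Literature.AlgebraicGeometry.Limits.LocApprox Literature.AlgebraicGeometry.Limits.OverFac
open Literature.AlgebraicGeometry.Motives (SchemeOver specOver)

/-! ## §1 `(Q_T)_G ≅ Q_G` is an isomorphism of group schemes for the INDUCED structures -/

section FacIso

variable {X : Scheme.{u}} {T G : Over X} (ℓ : G ⟶ T) (Q : Over X) [GrpObj Q]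

set_option backward.isDefEq.respectTransparency false in
/-- **`(Q_T)_G ≅ Q_G` is a homomorphism** for the group structures INDUCED by the base-change functors (`Functor.grpObjObj` on both sides):
unit and multiplication compatibilities are ★ `OverFac.map_ε_comp_facObjIso_hom` ∕ `map_μ_comp_facObjIso_hom` unfolded through
`η[F.obj M] = ε ≫ F.map η`, `μ[F.obj M] = μ_F ≫ F.map μ`. [cite: GortzWedhorn2020, §(4.7) Prop. 4.16] -/
theorem isMonHom_facObjIso_hom : IsMonHom (facObjIso ℓ Q).hom := by
  refine { one_hom := ?_, mul_hom := ?_ }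
  · rw [Functor.obj.η_def, Functor.obj.η_def, Functor.map_comp, Category.assoc, Category.assoc,
      pullbackFacObjIso_naturality, ← Category.assoc ((Over.pullback ℓ.left).map _), map_ε_comp_facObjIso_hom, Category.assoc,
      Functor.Monoidal.ε_η_assoc, Functor.obj.η_def]
  · rw [Functor.obj.μ_def, Functor.obj.μ_def, Functor.map_comp, Category.assoc, Category.assoc,
      pullbackFacObjIso_naturality, ← Category.assoc ((Over.pullback ℓ.left).map _), map_μ_comp_facObjIso_hom, Category.assoc,
      Category.assoc, Functor.Monoidal.μ_δ_assoc, Functor.obj.μ_def]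

/-- … hence so is its inverse (Mathlib). [cite: GortzWedhorn2020, §(4.7) Prop. 4.16] -/
theorem isMonHom_facObjIso_inv : IsMonHom (facObjIso ℓ Q).inv := by
  haveI := isMonHom_facObjIso_hom ℓ Q
  infer_instance

/-- **Conjugation by a group isomorphism commutes with finite products of integer powers** (pointwise products of `Hom` into commutative group
objects): `e ≫ (∏ f_j^{c_j}) ≫ e⁻¹ = ∏ (e ≫ f_j ≫ e⁻¹)^{c_j}`. [cite: MumfordAV1970, §19 (first paragraph)] -/
theorem conj_finsetProd_zpow {C : Type*} [Category C] [CartesianMonoidalCategory C] [BraidedCategory C] {M M' : C} [GrpObj M]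
    [IsCommMonObj M] [GrpObj M'] [IsCommMonObj M'] (e : M' ≅ M) [IsMonHom e.hom] [IsMonHom e.inv] {J : Type*} (s : Finset J)
    (f : J → (M ⟶ M)) (c : J → ℤ) :
    e.hom ≫ (∏ j ∈ s, f j ^ c j) ≫ e.inv = ∏ j ∈ s, (e.hom ≫ f j ≫ e.inv) ^ c j := by
  let φ : (M ⟶ M) →* (M' ⟶ M') :=
    { toFun := fun f => e.hom ≫ f ≫ e.inv
      map_one' := by rw [MonObj.one_comp, MonObj.comp_one]
      map_mul' := fun f g => by rw [MonObj.mul_comp, MonObj.comp_mul] }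
  change φ (∏ j ∈ s, f j ^ c j) = ∏ j ∈ s, φ (f j) ^ c j
  rw [map_prod]
  exact Finset.prod_congr rfl fun j _ => map_zpow φ (f j) (c j)

end FacIso

/-! ## §2 A homomorphism generically is a homomorphism at the stage; the base-change functor on products -/

section Stage

variable {A : Type u} [CommRing A] [IsDomain A] (K : Type u) [Field K] [Algebra A K] [IsFractionRing A K]
  {P : SchemeOver A} {s t : Idx (nonZeroDivisors A)} (σ : s ⟶ t)
  (𝒜ₜ : AbelianSchemeOver (P ⊗ (baseDiagram (nonZeroDivisors A)).obj t).left)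

/-- **A STAGE MORPHISM WHOSE GENERIC BASE CHANGE IS A HOMOMORPHISM IS A HOMOMORPHISM** (`𝒜ₜ`, `ℬₜ` abelian schemes over `P ⊗ D(t)`, the stage
`s` flat): the unit and multiplication compatibilities are equalities of morphisms from flat schemes (`𝟙`, `𝒜ₛ ⊗ 𝒜ₛ`) to the separated `ℬₛ`,
checked after the injective base change along the relative leg (★ FILE 1 `stage_hom_eq_of_generic_eq`), where `z` becomes `e ≫ ψ ≫ e′⁻¹` with
`e`, `e′` homomorphisms (§1). [cite: EGAIV3, 11.10.5] [cite: GortzWedhorn2020, Prop. 9.19 and Rem. 9.20] -/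
theorem isMonHom_of_pullback_map_eq [Flat (pullback.snd P.hom ((baseDiagram (nonZeroDivisors A)).obj s).hom)]
    (ℬₜ : AbelianSchemeOver (P ⊗ (baseDiagram (nonZeroDivisors A)).obj t).left)
    (z : (𝒜ₜ.baseChange (stageOver (nonZeroDivisors A) P σ).hom).X ⟶ (ℬₜ.baseChange (stageOver (nonZeroDivisors A) P σ).hom).X)
    (ψ : (𝒜ₜ.baseChange (genOver (nonZeroDivisors A) K P t).hom).X ⟶ (ℬₜ.baseChange (genOver (nonZeroDivisors A) K P t).hom).X)
    [IsMonHom ψ]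
    (hz : (Over.pullback (relLeg (nonZeroDivisors A) K P σ).left).map z ≫ (facObjIso (relLeg (nonZeroDivisors A) K P σ) ℬₜ.X).hom =
      (facObjIso (relLeg (nonZeroDivisors A) K P σ) 𝒜ₜ.X).hom ≫ ψ) :
    IsMonHom z := by
  -- the stage objects are flat (smooth) and separated (proper) over the stage
  haveI := (𝒜ₜ.baseChange (stageOver (nonZeroDivisors A) P σ).hom).isSmooth
  haveI := (ℬₜ.baseChange (stageOver (nonZeroDivisors A) P σ).hom).isProper
  -- the identifications `(𝒜ₛ)_K ≅ (𝒜ₜ)_K`, `(ℬₛ)_K ≅ (ℬₜ)_K`, typed in the `baseChange` spelling, are homomorphisms (§1)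
  let e𝒜 : (Over.pullback (relLeg (nonZeroDivisors A) K P σ).left).obj (𝒜ₜ.baseChange (stageOver (nonZeroDivisors A) P σ).hom).X ≅
      (𝒜ₜ.baseChange (genOver (nonZeroDivisors A) K P t).hom).X := facObjIso (relLeg (nonZeroDivisors A) K P σ) 𝒜ₜ.X
  let eℬ : (Over.pullback (relLeg (nonZeroDivisors A) K P σ).left).obj (ℬₜ.baseChange (stageOver (nonZeroDivisors A) P σ).hom).X ≅
      (ℬₜ.baseChange (genOver (nonZeroDivisors A) K P t).hom).X := facObjIso (relLeg (nonZeroDivisors A) K P σ) ℬₜ.X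
  haveI : IsMonHom e𝒜.hom := isMonHom_facObjIso_hom (relLeg (nonZeroDivisors A) K P σ) 𝒜ₜ.X
  haveI : IsMonHom eℬ.inv := isMonHom_facObjIso_inv (relLeg (nonZeroDivisors A) K P σ) ℬₜ.X
  have hz₁ : (Over.pullback (relLeg (nonZeroDivisors A) K P σ).left).map z ≫ eℬ.hom = e𝒜.hom ≫ ψ := hz
  have hz' : (Over.pullback (relLeg (nonZeroDivisors A) K P σ).left).map z = e𝒜.hom ≫ ψ ≫ eℬ.inv := by
    rw [← Category.assoc, ← hz₁, Category.assoc, Iso.hom_inv_id, Category.comp_id]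
  haveI : IsMonHom ((Over.pullback (relLeg (nonZeroDivisors A) K P σ).left).map z) := by rw [hz']; infer_instance
  refine { one_hom := ?_, mul_hom := ?_ }
  · -- units: `η ≫ z = η`, both from the flat `𝟙`
    haveI : Flat (𝟙_ (Over (stageOver (nonZeroDivisors A) P σ).left)).hom := inferInstanceAs (Flat (𝟙 _))
    apply stage_hom_eq_of_generic_eq K σ
    rw [Functor.map_comp, ← cancel_epi (Functor.LaxMonoidal.ε (Over.pullback (relLeg (nonZeroDivisors A) K P σ).left)),
      ← Category.assoc, ← Functor.obj.η_def, ← Functor.obj.η_def]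
    exact IsMonHom.one_hom _
  · -- multiplications: `μ ≫ z = (z ⊗ z) ≫ μ`, both from the flat `𝒜ₛ ⊗ 𝒜ₛ`
    haveI : Flat ((𝒜ₜ.baseChange (stageOver (nonZeroDivisors A) P σ).hom).X ⊗
        (𝒜ₜ.baseChange (stageOver (nonZeroDivisors A) P σ).hom).X).hom :=
      inferInstanceAs (Flat (pullback.fst _ _ ≫ _))
    apply stage_hom_eq_of_generic_eq K σ
    have hn := Functor.LaxMonoidal.μ_natural (Over.pullback (relLeg (nonZeroDivisors A) K P σ).left) z z
    rw [Functor.map_comp, Functor.map_comp,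
      ← cancel_epi (Functor.LaxMonoidal.μ (Over.pullback (relLeg (nonZeroDivisors A) K P σ).left) _ _), ← Category.assoc,
      ← Category.assoc, ← Functor.obj.μ_def, ← hn, Category.assoc, ← Functor.obj.μ_def]
    exact IsMonHom.mul_hom _

end Stage

/-! ## §3 The ring action at the stage -/

section RingActionSpread

variable {A : Type u} [CommRing A] [IsDomain A] (K : Type u) [Field K] [Algebra A K] [IsFractionRing A K]
  {P : SchemeOver A} [QuasiCompact P.hom] [QuasiSeparated P.hom] {t : Idx (nonZeroDivisors A)}
  (𝒜ₜ : AbelianSchemeOver (P ⊗ (baseDiagram (nonZeroDivisors A)).obj t).left) [IsCommMonObj 𝒜ₜ.X]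
  {O : Type*} [CommRing O]

/-- **A RING ACTION ON THE GENERIC BASE CHANGE SPREADS TO A FINER STAGE** ([EGAIV3] 8.8.2 (i) for the `n` endomorphisms `ι(b_j)`, then the
endomorphism-structure table of ★ `EndomorphismStructureLocus` at the stage): for `𝒜ₜ` over `P ⊗ D(t)` (commutative law, stage flat), an
order `O` with a `ℤ`-basis `bs`, and `ρ : RingAction O ((𝒜ₜ)_K)` on its base change along the leg `P ⊗ Spec K → P ⊗ D(t)`, there are a finer
stage `σ : s ⟶ t` and `ρₛ : RingAction O (𝒜ₜ ×_{P_t} (P ⊗ D(s)))` whose base change along the relative leg is `ρ` through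
`e : (𝒜ₛ)_K ≅ (𝒜ₜ)_K` (★ `OverFac.facObjIso`): `(ρₛ.i a)_K ≫ e = e ≫ ρ.i a` for all `a ∈ O`.  (The commutativity of the laws of the base
changes is the induced one, found by instance search; `bs` only enters the proof.) [cite: EGAIV3, Thm. 8.8.2 (i)] [cite: Kottwitz1992, §5 (p. 390)] -/
theorem exists_stage_ringAction [Flat (pullback.snd P.hom ((baseDiagram (nonZeroDivisors A)).obj t).hom)] {n : ℕ}
    (bs : Module.Basis (Fin n) ℤ O) (ρ : RingAction O (𝒜ₜ.baseChange (genOver (nonZeroDivisors A) K P t).hom)) :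
    ∃ (s : Idx (nonZeroDivisors A)) (σ : s ⟶ t) (ρₛ : RingAction O (𝒜ₜ.baseChange (stageOver (nonZeroDivisors A) P σ).hom)),
      ∀ a : O, (Over.pullback (relLeg (nonZeroDivisors A) K P σ).left).map (ρₛ.i a) ≫
          (facObjIso (relLeg (nonZeroDivisors A) K P σ) 𝒜ₜ.X).hom =
        (facObjIso (relLeg (nonZeroDivisors A) K P σ) 𝒜ₜ.X).hom ≫ ρ.i a := by
  haveI := 𝒜ₜ.isProper
  haveI := 𝒜ₜ.isSmooth
  haveI : QuasiCompact 𝒜ₜ.X.hom := inferInstance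
  haveI : QuasiSeparated 𝒜ₜ.X.hom := inferInstance
  haveI : LocallyOfFinitePresentation 𝒜ₜ.X.hom := inferInstance
  haveI : ∀ a, IsMonHom (ρ.i a) := ρ.isMonHom
  -- (1) spread the `n` endomorphisms `ρ(b_j)` to one stage
  obtain ⟨s, σ, z, hz⟩ : ∃ (s : Idx (nonZeroDivisors A)) (σ : s ⟶ t)
      (z : Fin n → ((𝒜ₜ.baseChange (stageOver (nonZeroDivisors A) P σ).hom).X ⟶ (𝒜ₜ.baseChange (stageOver (nonZeroDivisors A) P σ).hom).X)),
      ∀ j, (Over.pullback (relLeg (nonZeroDivisors A) K P σ).left).map (z j) ≫ (facObjIso (relLeg (nonZeroDivisors A) K P σ) 𝒜ₜ.X).hom =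
        (facObjIso (relLeg (nonZeroDivisors A) K P σ) 𝒜ₜ.X).hom ≫ ρ.i (bs j) :=
    exists_stage_homs_of_generic K 𝒜ₜ.X 𝒜ₜ.X (fun j : Fin n => ρ.i (bs j))
  haveI : Flat (pullback.snd P.hom ((baseDiagram (nonZeroDivisors A)).obj s).hom) :=
    MorphismProperty.of_isPullback (SubalgApprox.isPullback_whiskerLeft_left P ((baseDiagram (nonZeroDivisors A)).map σ)) ‹_›
  let ℓ := relLeg (nonZeroDivisors A) K P σ
  -- the identification `(𝒜ₛ)_K ≅ (𝒜ₜ)_K`, typed in the `baseChange` spelling (group structures found structurally)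
  let e : (Over.pullback ℓ.left).obj (𝒜ₜ.baseChange (stageOver (nonZeroDivisors A) P σ).hom).X ≅
      (𝒜ₜ.baseChange (genOver (nonZeroDivisors A) K P t).hom).X := facObjIso ℓ 𝒜ₜ.X
  -- commutativity of the base changes (induced, Mathlib)
  haveI : IsCommMonObj (𝒜ₜ.baseChange (genOver (nonZeroDivisors A) K P t).hom).X :=
    inferInstanceAs (IsCommMonObj ((Over.pullback (genOver (nonZeroDivisors A) K P t).hom).obj 𝒜ₜ.X))
  haveI : IsCommMonObj (𝒜ₜ.baseChange (stageOver (nonZeroDivisors A) P σ).hom).X :=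
    inferInstanceAs (IsCommMonObj ((Over.pullback (stageOver (nonZeroDivisors A) P σ).hom).obj 𝒜ₜ.X))
  haveI : IsCommMonObj ((Over.pullback ℓ.left).obj (𝒜ₜ.baseChange (stageOver (nonZeroDivisors A) P σ).hom).X) := inferInstance
  haveI : IsMonHom e.hom := isMonHom_facObjIso_hom ℓ 𝒜ₜ.X
  haveI : IsMonHom e.inv := isMonHom_facObjIso_inv ℓ 𝒜ₜ.X
  -- (2) the `z_j` are homomorphisms
  haveI : ∀ j, IsMonHom (z j) := fun j => isMonHom_of_pullback_map_eq K σ 𝒜ₜ 𝒜ₜ (z j) (ρ.i (bs j)) (hz j)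
  have hz₁ : ∀ j, (Over.pullback ℓ.left).map (z j) ≫ e.hom = e.hom ≫ ρ.i (bs j) := hz
  have hz' : ∀ j, (Over.pullback ℓ.left).map (z j) = e.hom ≫ ρ.i (bs j) ≫ e.inv := fun j => by
    rw [← Category.assoc, ← hz₁ j, Category.assoc, Iso.hom_inv_id, Category.comp_id]
  -- the base change of a product of powers of the `z_j` is the conjugate of the product of powers of the `ρ(b_j)`
  have hprod : ∀ c : Fin n → ℤ, (Over.pullback ℓ.left).map (∏ j, z j ^ c j) = e.hom ≫ (∏ j, ρ.i (bs j) ^ c j) ≫ e.inv := by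
    intro c
    rw [conj_finsetProd_zpow e Finset.univ (fun j => ρ.i (bs j)) c]
    change (Over.pullback ℓ.left).homMonoidHom (∏ j, z j ^ c j) = _
    rw [map_prod]
    exact Finset.prod_congr rfl fun j _ => by rw [map_zpow]; exact congrArg (· ^ c j) (hz' j)
  -- (3) the table identities at the stage, by injectivity of the base change along the relative leg
  haveI := (𝒜ₜ.baseChange (stageOver (nonZeroDivisors A) P σ).hom).isSmooth
  haveI := (𝒜ₜ.baseChange (stageOver (nonZeroDivisors A) P σ).hom).isProper
  haveI : Flat ((Over.pullback (stageOver (nonZeroDivisors A) P σ).hom).obj 𝒜ₜ.X).hom :=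
    inferInstanceAs (Flat (𝒜ₜ.baseChange (stageOver (nonZeroDivisors A) P σ).hom).X.hom)
  haveI : IsSeparated ((Over.pullback (stageOver (nonZeroDivisors A) P σ).hom).obj 𝒜ₜ.X).hom :=
    inferInstanceAs (IsSeparated (𝒜ₜ.baseChange (stageOver (nonZeroDivisors A) P σ).hom).X.hom)
  obtain ⟨hMgen, hUgen⟩ := structureTable_of_ringAction bs ρ
  have hM : ∀ k l, z l ≫ z k = ∏ j, z j ^ (bs.repr (bs k * bs l) j) := by
    intro k l
    apply stage_hom_eq_of_generic_eq K σ
    rw [Functor.map_comp, hz' l, hz' k, hprod, ← hMgen k l]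
    simp only [Category.assoc, Iso.inv_hom_id_assoc]
  have hU : 𝟙 (𝒜ₜ.baseChange (stageOver (nonZeroDivisors A) P σ).hom).X = ∏ j, z j ^ (bs.repr 1 j) := by
    apply stage_hom_eq_of_generic_eq K σ
    rw [CategoryTheory.Functor.map_id, hprod, ← hUgen, Category.id_comp, Iso.hom_inv_id]
  -- (4) the ring action at the stage and its restriction
  obtain ⟨ρₛ, hρₛ⟩ := exists_ringAction_of_structureTable (A := 𝒜ₜ.baseChange (stageOver (nonZeroDivisors A) P σ).hom) bs z hM hU
  refine ⟨s, σ, ρₛ, fun a => ?_⟩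
  change (Over.pullback ℓ.left).map (ρₛ.i a) ≫ e.hom = e.hom ≫ ρ.i a
  rw [i_eq_finsetProd_zpow bs ρₛ a, i_eq_finsetProd_zpow bs ρ a]
  simp_rw [hρₛ]
  rw [hprod, Category.assoc, Category.assoc, Iso.inv_hom_id, Category.comp_id]

end RingActionSpread

/-! ## §4 A HOMOMORPHISM on the generic base changes spreads to a homomorphism at a finer stage (ED. 2; the `λ`-half of (s2)) -/

section HomSpread

variable {A : Type u} [CommRing A] [IsDomain A] (K : Type u) [Field K] [Algebra A K] [IsFractionRing A K]
  {P : SchemeOver A} [QuasiCompact P.hom] [QuasiSeparated P.hom] {t : Idx (nonZeroDivisors A)}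
  (𝒜ₜ ℬₜ : AbelianSchemeOver (P ⊗ (baseDiagram (nonZeroDivisors A)).obj t).left)

/-- **A HOMOMORPHISM BETWEEN THE GENERIC BASE CHANGES OF TWO STAGE ABELIAN SCHEMES SPREADS TO A HOMOMORPHISM AT A FINER STAGE**
([EGAIV3] 8.8.2 (i) for the one morphism, ★ `Limits/LocalizationRelativeHomSpread`; homomorphism at the stage by §2): for `𝒜ₜ`, `ℬₜ` over
`P ⊗ D(t)` (stage flat) and a homomorphism `f : (𝒜ₜ)_K → (ℬₜ)_K` of their base changes along the cone leg, there are `σ : s ⟶ t` and a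
homomorphism `fₛ : 𝒜ₜ|ₛ → ℬₜ|ₛ` of the restrictions whose base change along the relative leg is `f` through the identifications
`(𝒜ₜ|ₛ)_K ≅ (𝒜ₜ)_K`, `(ℬₜ|ₛ)_K ≅ (ℬₜ)_K` (★ `OverFac.facObjIso`).  With `ℬₜ := Dₜ.hat` this is the `λ`-half of the spread of a polarization
(the ampleness clause at the geometric points of the stage is a separate organ). [cite: EGAIV3, Thm. 8.8.2 (i)]
[cite: MumfordFogartyKirwan1994, Ch. 6 §2 Definition 6.3 (p. 120)] -/
theorem exists_stage_monHom [Flat (pullback.snd P.hom ((baseDiagram (nonZeroDivisors A)).obj t).hom)]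
    (f : (𝒜ₜ.baseChange (genOver (nonZeroDivisors A) K P t).hom).X ⟶ (ℬₜ.baseChange (genOver (nonZeroDivisors A) K P t).hom).X)
    [IsMonHom f] :
    ∃ (s : Idx (nonZeroDivisors A)) (σ : s ⟶ t)
      (fₛ : (𝒜ₜ.baseChange (stageOver (nonZeroDivisors A) P σ).hom).X ⟶ (ℬₜ.baseChange (stageOver (nonZeroDivisors A) P σ).hom).X),
      IsMonHom fₛ ∧
        (Over.pullback (relLeg (nonZeroDivisors A) K P σ).left).map fₛ ≫ (facObjIso (relLeg (nonZeroDivisors A) K P σ) ℬₜ.X).hom =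
          (facObjIso (relLeg (nonZeroDivisors A) K P σ) 𝒜ₜ.X).hom ≫ f := by
  haveI := 𝒜ₜ.isProper
  haveI := ℬₜ.isSmooth
  haveI : QuasiCompact 𝒜ₜ.X.hom := inferInstance
  haveI : QuasiSeparated 𝒜ₜ.X.hom := inferInstance
  haveI : LocallyOfFinitePresentation ℬₜ.X.hom := inferInstance
  obtain ⟨s, σ, z, hz⟩ : ∃ (s : Idx (nonZeroDivisors A)) (σ : s ⟶ t)
      (z : Unit → ((𝒜ₜ.baseChange (stageOver (nonZeroDivisors A) P σ).hom).X ⟶ (ℬₜ.baseChange (stageOver (nonZeroDivisors A) P σ).hom).X)),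
      ∀ j, (Over.pullback (relLeg (nonZeroDivisors A) K P σ).left).map (z j) ≫ (facObjIso (relLeg (nonZeroDivisors A) K P σ) ℬₜ.X).hom =
        (facObjIso (relLeg (nonZeroDivisors A) K P σ) 𝒜ₜ.X).hom ≫ f :=
    exists_stage_homs_of_generic K 𝒜ₜ.X ℬₜ.X (fun _ : Unit => f)
  haveI : Flat (pullback.snd P.hom ((baseDiagram (nonZeroDivisors A)).obj s).hom) :=
    MorphismProperty.of_isPullback (SubalgApprox.isPullback_whiskerLeft_left P ((baseDiagram (nonZeroDivisors A)).map σ)) ‹_›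
  exact ⟨s, σ, z (), isMonHom_of_pullback_map_eq K σ 𝒜ₜ ℬₜ (z ()) f (hz ()), hz ()⟩

end HomSpread

end AbelianSchemeOver

end Literature.AlgebraicGeometry.AbelianSchemes

end
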